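import Summits.KontsevichZagierPeriods.KontsevichZagierPeriods.Theorems.RootDecompWalshStrataPtypeSections

/-!
# Root decomposition (Walsh strata), part 45 — P-type fibre discriminants II: the two engines

The P-TYPE RADICAND `R = ε·y + (e x² + f x + g)` (`prad`) on an open piece `U ⊆ [0,1]²` whose frontier lies
on the wall locus `wallLocus R ℓ q` (the zero set `R = 0`, genuine rational lines, conic walls `R = q_j²`
with rational-affine `q_j`): `[U, γ√R] ∈ InBaker`.

* ENGINE-Y (`ε ≠ 0`, 45.2): the planar-sections engine with the potential `(2γ/3ε)·R√R`
  (`∂/∂y = γ√R` where `R > 0`); sections: `R = 0` ↦ zero integrand; a line `y = −(k₀ + k₁x)/k₂` ↦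
  `[T, c·D'(x)√D'(x)]` with `D'` quadratic (`InBaker.poly_sqrt`); a conic wall `R = q²`, `s·q ≥ 0` ↦
  `√R = s·q`, so the section is the cubic `c s·q(x, ζ x)³` in the root `ζ` of the non-degenerate conic
  `q² − R` (`InBaker.conic_section3` after removing the polynomial part `c s (k₀ + k₁x)³`).
* ENGINE-X (`ε = 0`, 45.3): potential `γ√(e x² + f x + g)·y` (`∂/∂y = γ√R` everywhere); sections:
  zero; `InBaker.affine_sqrt` on lines; `InBaker.conic_section` on conic walls, whose non-degeneracy is
  the hypothesis `R ≢ q_j²`.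
* 45.4 `InBaker.of_Prad`: both engines under one signature.

References: [KontsevichZagier2001 §1.2 rules (1)–(3)], [BCR1998 §2.2].
-/

noncomputable section
/-- `(x, t)₀ = x₀` on `Fin 2`. [bookkeeping] -/
private theorem snoc₂_zero (x : Fin 1 → ℝ) (t : ℝ) : (Fin.snoc x t : Fin 2 → ℝ) 0 = x 0 := rfl

/-- `(x, t)₁ = t` on `Fin 2`. [bookkeeping] -/
private theorem snoc₂_one (x : Fin 1 → ℝ) (t : ℝ) : (Fin.snoc x t : Fin 2 → ℝ) 1 = t := rfl

open Set MeasureTheory MvPolynomial Literature.NumberTheory.Transcendental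
open Literature.ModelTheory.ExponentialFields (IsSemialgebraic isSemialgebraic_univ isSemialgebraic_empty)

namespace Summit.KontsevichZagierPeriods.RootDecompWalshStrata.ConicDescent.BallCube

/-! #### 45.1 The P-type radicand, its potentials, and the conic of a conic wall -/

/-- The P-TYPE RADICAND `ε·y + (e x² + f x + g)`: the normal form, after a rational shear, of a planar
quadratic polynomial whose quadratic part has vanishing discriminant. -/
def prad (ε e f g : ℚ) (w : Fin 2 → ℝ) : ℝ := (ε : ℝ) * w 1 + qD e f g (w 0)

/-- The Y-POTENTIAL `(2γ/(3ε))·R·√R` of the weight `γ√R` (`ε ≠ 0`). -/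
def ypot (γ ε e f g : ℚ) (w : Fin 2 → ℝ) : ℝ :=
  ((2 * γ / (3 * ε) : ℚ) : ℝ) * (prad ε e f g w * √(prad ε e f g w))

/-- The X-POTENTIAL `γ√(e x² + f x + g)·y` of the weight `γ√(e x² + f x + g)` (`ε = 0`). -/
def xpot (γ e f g : ℚ) (w : Fin 2 → ℝ) : ℝ := (γ : ℝ) * √(qD e f g (w 0)) * w 1

/-- The CONIC OF A CONIC WALL: `q(x, y)² − (ε y + e x² + f x + g)` for the rational-affine `q = L`. -/
def pconic (ε e f g : ℚ) (L : Wall) : Conic :=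
  ⟨L.k2 ^ 2, 2 * L.k0 * L.k2 - ε, 2 * L.k1 * L.k2, L.k0 ^ 2 - g, 2 * L.k0 * L.k1 - f, L.k1 ^ 2 - e⟩

section defs

variable (γ ε e f g : ℚ)

/-- Auxiliary step `prad_snoc`. [bookkeeping] -/
theorem prad_snoc (x : Fin 1 → ℝ) (t : ℝ) :
    prad ε e f g (Fin.snoc x t : Fin 2 → ℝ) = (ε : ℝ) * t + qD e f g (x 0) := rfl

/-- The P-type radicand is continuous. [bookkeeping] -/
theorem continuous_prad : Continuous (prad ε e f g) := by
  unfold prad qD; fun_prop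

/-- The P-type radicand is `ℚ`-semialgebraic. [BCR1998 §2.2] -/
theorem isSemialgebraicFunOn_prad {s : Set (Fin 2 → ℝ)} (hs : IsSemialgebraic ℚ s) :
    IsSemialgebraicFunOn ℚ s (prad ε e f g) :=
  (isSemialgebraicFunOn_aeval hs (C ε * X 1 + (C e * X 0 ^ 2 + C f * X 0 + C g) : MvPolynomial (Fin 2) ℚ)).congr
    fun w _ => by
      simp only [prad, qD, map_add, map_mul, map_pow, MvPolynomial.aeval_C, MvPolynomial.aeval_X, eq_ratCast]

/-- The Y-potential is continuous. [bookkeeping] -/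
theorem continuous_ypot : Continuous (ypot γ ε e f g) :=
  continuous_const.mul ((continuous_prad ε e f g).mul (continuous_prad ε e f g).sqrt)

/-- The Y-potential is `ℚ`-semialgebraic. [BCR1998 §2.2] -/
theorem isSemialgebraicFunOn_ypot : IsSemialgebraicFunOn ℚ univ (ypot γ ε e f g) :=
  ((isSemialgebraicFunOn_ratCast isSemialgebraic_univ (2 * γ / (3 * ε))).mul_holds
    ((isSemialgebraicFunOn_prad ε e f g isSemialgebraic_univ).mul_holds
      (IsSemialgebraicFunOn.sqrt_holds (isSemialgebraicFunOn_prad ε e f g isSemialgebraic_univ)))).congr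
    fun w _ => by simp only [ypot, Pi.mul_apply]

/-- The X-potential is continuous. [bookkeeping] -/
theorem continuous_xpot : Continuous (xpot γ e f g) := by
  unfold xpot qD; fun_prop

/-- The X-potential is `ℚ`-semialgebraic. [BCR1998 §2.2] -/
theorem isSemialgebraicFunOn_xpot : IsSemialgebraicFunOn ℚ univ (xpot γ e f g) :=
  (((isSemialgebraicFunOn_ratCast isSemialgebraic_univ γ).mul_holds
    (IsSemialgebraicFunOn.sqrt_holds (isSemialgebraicFunOn_aeval isSemialgebraic_univ
      (C e * X 0 ^ 2 + C f * X 0 + C g : MvPolynomial (Fin 2) ℚ)))).mul_holds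
    (isSemialgebraicFunOn_aeval isSemialgebraic_univ (X 1 : MvPolynomial (Fin 2) ℚ))).congr
    fun w _ => by
      simp only [xpot, qD, Pi.mul_apply, map_add, map_mul, map_pow, MvPolynomial.aeval_C,
        MvPolynomial.aeval_X, eq_ratCast]

/-- Auxiliary step `snoc_init_zero`. [bookkeeping] -/
private theorem snoc_init_zero (z : Fin 2 → ℝ) (s : ℝ) : (Fin.snoc (Fin.init z) s : Fin 2 → ℝ) 0 = z 0 := by
  have : (0 : Fin 2) = Fin.castSucc (0 : Fin 1) := rfl
  rw [this, Fin.snoc_castSucc]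
  rfl

/-- Auxiliary step `snoc_init_one`. [bookkeeping] -/
private theorem snoc_init_one (z : Fin 2 → ℝ) (s : ℝ) : (Fin.snoc (Fin.init z) s : Fin 2 → ℝ) 1 = s := by
  have : (1 : Fin 2) = Fin.last 1 := rfl
  rw [this, Fin.snoc_last]

/-- `∂/∂y [(2γ/3ε)·R√R] = γ√R` where `R > 0`, in the engine's `Fin.snoc` form. [this node] -/
theorem hasDerivAt_ypot_snoc (hε : ε ≠ 0) (z : Fin 2 → ℝ) (hz : 0 < prad ε e f g z) :
    HasDerivAt (fun s : ℝ => ypot γ ε e f g (Fin.snoc (Fin.init z) s))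
      ((γ : ℝ) * √(prad ε e f g z)) (z (Fin.last 1)) := by
  have hf : (fun s : ℝ => ypot γ ε e f g (Fin.snoc (Fin.init z) s)) = fun s =>
      ((2 * γ / (3 * ε) : ℚ) : ℝ) *
        (((ε : ℝ) * s + qD e f g (z 0)) * √((ε : ℝ) * s + qD e f g (z 0))) := by
    funext s
    rw [ypot, prad, snoc_init_zero, snoc_init_one]
  rw [hf, show z (Fin.last 1) = z 1 from rfl]
  have hu0 : (ε : ℝ) * z 1 + qD e f g (z 0) = prad ε e f g z := rfl
  have hu : HasDerivAt (fun s : ℝ => (ε : ℝ) * s + qD e f g (z 0)) ε (z 1) := by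
    simpa using ((hasDerivAt_id (z 1)).const_mul (ε : ℝ)).add_const (qD e f g (z 0))
  have hsq : HasDerivAt (fun s : ℝ => √((ε : ℝ) * s + qD e f g (z 0)))
      ((ε : ℝ) / (2 * √(prad ε e f g z))) (z 1) := by
    have h := hu.sqrt (by rw [hu0]; exact hz.ne')
    rw [hu0] at h
    exact h
  refine ((hu.mul hsq).const_mul (((2 * γ / (3 * ε) : ℚ) : ℝ))).congr_deriv ?_
  rw [hu0]
  have hs0 : 0 < √(prad ε e f g z) := Real.sqrt_pos.2 hz
  have key : prad ε e f g z / √(prad ε e f g z) = √(prad ε e f g z) := by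
    rw [div_eq_iff hs0.ne', Real.mul_self_sqrt hz.le]
  have hε' : (ε : ℝ) ≠ 0 := by exact_mod_cast hε
  calc ((2 * γ / (3 * ε) : ℚ) : ℝ) *
        ((ε : ℝ) * √(prad ε e f g z) + prad ε e f g z * ((ε : ℝ) / (2 * √(prad ε e f g z))))
      = ((2 * γ / (3 * ε) : ℚ) : ℝ) *
          ((ε : ℝ) * √(prad ε e f g z) + (ε : ℝ) / 2 * (prad ε e f g z / √(prad ε e f g z))) := by
        ring
    _ = (γ : ℝ) * √(prad ε e f g z) := by
        rw [key]
        push_cast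
        field_simp
        ring

/-- `∂/∂y [γ√(e x² + f x + g)·y] = γ√(e x² + f x + g)`, in the engine's `Fin.snoc` form. [this node] -/
theorem hasDerivAt_xpot_snoc (z : Fin 2 → ℝ) :
    HasDerivAt (fun s : ℝ => xpot γ e f g (Fin.snoc (Fin.init z) s))
      ((γ : ℝ) * √(qD e f g (z 0))) (z (Fin.last 1)) := by
  have hf : (fun s : ℝ => xpot γ e f g (Fin.snoc (Fin.init z) s)) = fun s =>
      ((γ : ℝ) * √(qD e f g (z 0))) * s := by
    funext s
    rw [xpot, snoc_init_zero, snoc_init_one]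
  rw [hf]
  simpa using (hasDerivAt_id (z (Fin.last 1))).const_mul ((γ : ℝ) * √(qD e f g (z 0)))

variable (L : Wall)

/-- The conic of a conic wall evaluates to `q² − R`. [bookkeeping] -/
theorem pconic_pxy (x y : ℝ) :
    (pconic ε e f g L).pxy x y = (L.eval x y) ^ 2 - ((ε : ℝ) * y + qD e f g x) := by
  simp only [pconic, Conic.pxy, Conic.Bx, Conic.Cx, Wall.eval, qD]
  push_cast
  ring

/-- For `ε ≠ 0` the conic of a conic wall is never identically zero. [this node] -/
theorem pconic_nondeg (hε : ε ≠ 0) : ∃ x y : ℝ, (pconic ε e f g L).pxy x y ≠ 0 := by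
  by_contra h
  simp only [not_exists, ne_eq, not_not] at h
  have h0 := quad_coeffs_eq_zero (L.k0 ^ 2 - g) (2 * L.k0 * L.k2 - ε) (L.k2 ^ 2) fun y => by
    have hy := h 0 y
    rw [pconic_pxy, Wall.eval, qD] at hy
    push_cast at hy ⊢
    linear_combination hy
  obtain ⟨-, h1, h2⟩ := h0
  have hk2 : L.k2 = 0 := (pow_eq_zero_iff two_ne_zero).1 h2
  rw [hk2, mul_zero, zero_sub, neg_eq_zero] at h1
  exact hε h1

/-- A witness `R(w) ≠ q(w)²` makes the conic of the conic wall non-degenerate. [bookkeeping] -/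
theorem pconic_nondeg_of_ne {w : Fin 2 → ℝ} (hw : prad ε e f g w ≠ (L.eval (w 0) (w 1)) ^ 2) :
    ∃ x y : ℝ, (pconic ε e f g L).pxy x y ≠ 0 :=
  ⟨w 0, w 1, by rw [pconic_pxy, ← prad.eq_def]; exact fun h => hw (by
    have : prad ε e f g w = (ε : ℝ) * w 1 + qD e f g (w 0) := rfl
    linarith)⟩

/-- On a conic wall with a definite sign, `√R = s·q`. [bookkeeping] -/
theorem sqrt_eq_of_wall {s : ℚ} (hs : s = 1 ∨ s = -1) {R t : ℝ} (hR : R = t ^ 2) (hsg : 0 ≤ (s : ℝ) * t) :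
    √R = (s : ℝ) * t := by
  have hss : t ^ 2 = ((s : ℝ) * t) ^ 2 := by
    rcases hs with rfl | rfl <;> push_cast <;> ring
  rw [hR, hss, Real.sqrt_sq hsg]

end defs

/-! #### 45.2 ENGINE-Y: `ε ≠ 0` -/

/-- **ENGINE-Y.**  For `ε ≠ 0`, an open piece `U ⊆ [0,1]²` on which `R = ε y + e x² + f x + g > 0` and whose
frontier lies on the wall locus of `R`, arbitrary rational lines `ℓ` and arbitrary conic walls `q`:
`[U, γ√R] ∈ InBaker`. [KontsevichZagier2001 §1.2 rules (1)–(3); this node] -/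
theorem InBaker.of_Yrad (γ ε e f g : ℚ) (hε : ε ≠ 0) {n m : ℕ} (ℓ : Fin n → Wall) (q : Fin m → Wall)
    (σ : KZ.IntegralRep 2) (hσo : IsOpen σ.domain) (hσI : σ.domain ⊆ Icc 0 1)
    (hD : ∀ w ∈ σ.domain, 0 < prad ε e f g w)
    (hσi : ∀ w ∈ σ.domain, σ.integrand w = (γ : ℝ) * √(prad ε e f g w))
    (hfr : ∀ w ∈ closure σ.domain, w ∉ σ.domain → w ∈ wallLocus (prad ε e f g) ℓ q) :
    InBaker (KZ.of σ) := by
  classical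
  refine InBaker.of_planar_sections (N := 1) hσo σ.isSemialgebraic_domain hσI (ypot γ ε e f g)
    (isSemialgebraicFunOn_ypot γ ε e f g) (continuous_ypot γ ε e f g) σ rfl (fun z hz => ?_)
    fun S ζ hS hζ _ hgr r₁ hr₁d hr₁i => ?_
  · rw [hσi z hz]
    exact hasDerivAt_ypot_snoc γ ε e f g hε z (hD z hz)
  have hxS : ∀ {T : Set (Fin 1 → ℝ)}, T ⊆ r₁.domain → ∀ {x}, x ∈ T → x ∈ S := fun hTr x hx => by
    rw [← hr₁d]; exact hTr hx
  have hint : ∀ x ∈ S, r₁.integrand x = ((2 * γ / (3 * ε) : ℚ) : ℝ) *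
      (prad ε e f g (Fin.snoc x (ζ x)) * √(prad ε e f g (Fin.snoc x (ζ x)))) := fun x hx => hr₁i hx
  refine InBaker.of_wall_sections (prad ε e f g) (isSemialgebraicFunOn_prad ε e f g isSemialgebraic_univ)
    ℓ q hσo hσI hfr hS hζ hgr r₁ hr₁d ?_ ?_ ?_
  · -- `R = 0` along the graph: zero integrand
    intro T hT hTr _ h0
    refine InBaker.of_mem_relations (KZ.of_mem_relations_of_eqOn_zero _ fun x hx => ?_)
    show r₁.integrand x = 0
    rw [hint x (hxS hTr hx), h0 x hx, zero_mul, mul_zero]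
  · -- a line `y = −(k₀ + k₁ x)/k₂`: `R` becomes a quadratic in `x`
    intro i T hT hTr hTI h2 hlin
    have h2' : ((ℓ i).k2 : ℝ) ≠ 0 := by exact_mod_cast h2
    have hR : ∀ v ∈ T, prad ε e f g (Fin.snoc v (ζ v)) =
        qD e (f - ε * (ℓ i).k1 / (ℓ i).k2) (g - ε * (ℓ i).k0 / (ℓ i).k2) (v 0) := fun v hv => by
      rw [prad_snoc, hlin v hv, qD, qD]
      push_cast
      field_simp
      ring
    refine InBaker.poly_sqrt e (f - ε * (ℓ i).k1 / (ℓ i).k2) (g - ε * (ℓ i).k0 / (ℓ i).k2)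
      (Polynomial.C (2 * γ / (3 * ε)) * (Polynomial.C e * Polynomial.X ^ 2 +
        Polynomial.C (f - ε * (ℓ i).k1 / (ℓ i).k2) * Polynomial.X +
        Polynomial.C (g - ε * (ℓ i).k0 / (ℓ i).k2)))
      (r₁.restrict T hT hTr) hTI fun v hv => ?_
    show r₁.integrand v = _
    rw [hint v (hxS hTr hv), hR v hv]
    simp only [map_add, map_mul, map_pow, Polynomial.aeval_C, Polynomial.aeval_X, eq_ratCast, qD]
    ring
  · -- a conic wall `R = q²`, `s·q ≥ 0`: the cubic `c s·q³` in the root `ζ` of `q² − R`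
    intro j s hs T hT hTr hTI hζT hcj
    have hQ := pconic_nondeg ε e f g (q j) hε
    have hroot : ∀ v ∈ T, (pconic ε e f g (q j)).pxy (v 0) (ζ v) = 0 := fun v hv => by
      rw [pconic_pxy, ← prad_snoc, (hcj v hv).1, sub_self]
    have hsqrt : ∀ v ∈ T, √(prad ε e f g (Fin.snoc v (ζ v))) = (s : ℝ) * (q j).eval (v 0) (ζ v) :=
      fun v hv => sqrt_eq_of_wall hs (hcj v hv).1 (hcj v hv).2
    refine InBaker.of_sub' (r₁.restrict T hT hTr)
      (polyRep₁ T hT hTI (C (2 * γ / (3 * ε) * s) * (C (q j).k0 + C (q j).k1 * X 0) ^ 3)) rfl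
      (InBaker.of_eqOn_aeval _ (C (2 * γ / (3 * ε) * s) * (C (q j).k0 + C (q j).k1 * X 0) ^ 3)
        fun v _ => rfl) ?_
    refine InBaker.conic_section3 (pconic ε e f g (q j)) hQ
      ⟨3 * (2 * γ / (3 * ε) * s) * (q j).k2 ^ 3, 6 * (2 * γ / (3 * ε) * s) * (q j).k2 ^ 2 * (q j).k0,
        6 * (2 * γ / (3 * ε) * s) * (q j).k2 ^ 2 * (q j).k1, 3 * (2 * γ / (3 * ε) * s) * (q j).k2 * (q j).k0 ^ 2,
        6 * (2 * γ / (3 * ε) * s) * (q j).k2 * (q j).k0 * (q j).k1,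
        3 * (2 * γ / (3 * ε) * s) * (q j).k2 * (q j).k1 ^ 2⟩
      _ hTI ζ hζT hroot fun v hv => ?_
    rw [subRep_integrand, polyRep₁_integrand]
    show r₁.integrand v - _ = _
    rw [hint v (hxS hTr hv), hsqrt v hv, (hcj v hv).1]
    simp only [Conic.Cx, Conic.Bx, Wall.eval, map_add, map_mul, map_pow, MvPolynomial.aeval_C,
      MvPolynomial.aeval_X, eq_ratCast]
    push_cast
    ring

/-! #### 45.3 ENGINE-X: `ε = 0` -/

/-- **ENGINE-X.**  For the radicand `R = e x² + f x + g` (`ε = 0`), an open piece `U ⊆ [0,1]²` whose frontier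
lies on the wall locus of `R`, arbitrary rational lines and conic walls `q_j` with `R ≢ q_j²`:
`[U, γ√R] ∈ InBaker`. [KontsevichZagier2001 §1.2 rules (1)–(3); this node] -/
theorem InBaker.of_Xrad (γ e f g : ℚ) {n m : ℕ} (ℓ : Fin n → Wall) (q : Fin m → Wall)
    (hq : ∀ j, ∃ w : Fin 2 → ℝ, prad 0 e f g w ≠ ((q j).eval (w 0) (w 1)) ^ 2)
    (σ : KZ.IntegralRep 2) (hσo : IsOpen σ.domain) (hσI : σ.domain ⊆ Icc 0 1)
    (hσi : ∀ w ∈ σ.domain, σ.integrand w = (γ : ℝ) * √(prad 0 e f g w))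
    (hfr : ∀ w ∈ closure σ.domain, w ∉ σ.domain → w ∈ wallLocus (prad 0 e f g) ℓ q) :
    InBaker (KZ.of σ) := by
  classical
  have hp0 : ∀ w : Fin 2 → ℝ, prad 0 e f g w = qD e f g (w 0) := fun w => by
    rw [prad, Rat.cast_zero, zero_mul, zero_add]
  refine InBaker.of_planar_sections (N := 1) hσo σ.isSemialgebraic_domain hσI (xpot γ e f g)
    (isSemialgebraicFunOn_xpot γ e f g) (continuous_xpot γ e f g) σ rfl (fun z hz => ?_)
    fun S ζ hS hζ _ hgr r₁ hr₁d hr₁i => ?_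
  · rw [hσi z hz, hp0]
    exact hasDerivAt_xpot_snoc γ e f g z
  have hxS : ∀ {T : Set (Fin 1 → ℝ)}, T ⊆ r₁.domain → ∀ {x}, x ∈ T → x ∈ S := fun hTr x hx => by
    rw [← hr₁d]; exact hTr hx
  have hint : ∀ x ∈ S, r₁.integrand x = (γ : ℝ) * √(prad 0 e f g (Fin.snoc x (ζ x))) * ζ x :=
    fun x hx => by rw [hr₁i hx]; simp only [xpot, snoc₂_zero, snoc₂_one, hp0]
  refine InBaker.of_wall_sections (prad 0 e f g) (isSemialgebraicFunOn_prad 0 e f g isSemialgebraic_univ)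
    ℓ q hσo hσI hfr hS hζ hgr r₁ hr₁d ?_ ?_ ?_
  · -- `R = 0` along the graph: zero integrand
    intro T hT hTr _ h0
    refine InBaker.of_mem_relations (KZ.of_mem_relations_of_eqOn_zero _ fun x hx => ?_)
    show r₁.integrand x = 0
    rw [hint x (hxS hTr hx), h0 x hx, Real.sqrt_zero, mul_zero, zero_mul]
  · -- a line `y = −(k₀ + k₁ x)/k₂`: an affine multiple of `√R(x)`
    intro i T hT hTr hTI h2 hlin
    have h2' : ((ℓ i).k2 : ℝ) ≠ 0 := by exact_mod_cast h2
    refine InBaker.affine_sqrt e f g (-(γ * (ℓ i).k0 / (ℓ i).k2)) (-(γ * (ℓ i).k1 / (ℓ i).k2))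
      (r₁.restrict T hT hTr) hTI fun v hv => ?_
    show r₁.integrand v = _
    rw [hint v (hxS hTr hv), hlin v hv, prad_snoc, Rat.cast_zero, zero_mul, zero_add]
    push_cast
    field_simp
    ring
  · -- a conic wall `R = q²`, `s·q ≥ 0`: `(γ s q)·ζ` in the root `ζ` of the non-degenerate conic `q² − R`
    intro j s hs T hT hTr hTI hζT hcj
    obtain ⟨w, hw⟩ := hq j
    have hQ := pconic_nondeg_of_ne 0 e f g (q j) hw
    have hroot : ∀ v ∈ T, (pconic 0 e f g (q j)).pxy (v 0) (ζ v) = 0 := fun v hv => by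
      rw [pconic_pxy, ← prad_snoc, (hcj v hv).1, sub_self]
    have hsqrt : ∀ v ∈ T, √(prad 0 e f g (Fin.snoc v (ζ v))) = (s : ℝ) * (q j).eval (v 0) (ζ v) :=
      fun v hv => sqrt_eq_of_wall hs (hcj v hv).1 (hcj v hv).2
    refine InBaker.conic_section (pconic 0 e f g (q j)) hQ (γ * s * (q j).k0) (γ * s * (q j).k1)
      (2 * γ * s * (q j).k2) (r₁.restrict T hT hTr) hTI ζ hζT hroot fun v hv => ?_
    show r₁.integrand v = _
    rw [hint v (hxS hTr hv), hsqrt v hv, Wall.eval]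
    push_cast
    ring

/-! #### 45.4 Both engines under one signature -/

/-- **P-TYPE PIECES OF THE UNIT SQUARE.**  An open piece `U ⊆ [0,1]²` with `R = ε y + e x² + f x + g > 0` on `U`
and frontier on the wall locus of `R`, lines `ℓ`, conic walls `q` (non-degenerate when `ε = 0`):
`[U, γ√R] ∈ InBaker`. [KontsevichZagier2001 §1.2; this node] -/
theorem InBaker.of_Prad (γ ε e f g : ℚ) {n m : ℕ} (ℓ : Fin n → Wall) (q : Fin m → Wall)
    (hq : ε ≠ 0 ∨ ∀ j, ∃ w : Fin 2 → ℝ, prad ε e f g w ≠ ((q j).eval (w 0) (w 1)) ^ 2)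
    (σ : KZ.IntegralRep 2) (hσo : IsOpen σ.domain) (hσI : σ.domain ⊆ Icc 0 1)
    (hD : ∀ w ∈ σ.domain, 0 < prad ε e f g w)
    (hσi : ∀ w ∈ σ.domain, σ.integrand w = (γ : ℝ) * √(prad ε e f g w))
    (hfr : ∀ w ∈ closure σ.domain, w ∉ σ.domain → w ∈ wallLocus (prad ε e f g) ℓ q) :
    InBaker (KZ.of σ) := by
  by_cases hε : ε = 0
  · subst hε
    exact InBaker.of_Xrad γ e f g ℓ q (hq.resolve_left fun h => h rfl) σ hσo hσI hσi hfr
  · exact InBaker.of_Yrad γ ε e f g hε ℓ q σ hσo hσI hD hσi hfr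

end Summit.KontsevichZagierPeriods.RootDecompWalshStrata.ConicDescent.BallCube

end
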